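import Summits.QuantumFields.YangMills.Theorems.ColdStartUniversalityLatticeLangevinHopfLax
import HarnessLib

/-!
# KUWADA'S DUALITY, abstract step: for a Markov kernel `P` on a compact metric space with (a) the pointwise `L²` gradient bound for Lipschitz
# observables `|P F(x') − P F(x)| ≤ a·(sup_ball P G²)^{1/2}·d(x,x')` and (b) the strong Feller bound `|P G(x') − P G(x)| ≤ b·‖G‖·d(x,x')`, the
# Hopf–Lax flow `s ↦ P(Q_s g)(γ_s)` along a geodesic grows at rate at most `a²·d(x,y)²/2`, up to `O(δ^{3/2})` per step of length `δ`

Seat `ym-line-csu-p1` (g42), route `ColdStartUniversality` of `Summits/QuantumFields/YangMills`, helper file G64a (`--supports stmt-QuantumFields-24809`).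
GENERIC (any compact metric space `X`, any Markov kernel `κ`; instantiated in the sequel with `X = SU(2)^E`, `ρ_L`, and the `SU(2)` lattice Langevin
kernel `κ_t`, for which (a) is G63c and (b) is G61).  The two one-sided Hopf–Lax inequalities of G62 are integrated against the kernel:

* ★★ `kuwada_stepA` — SPACE step: `∫Q_s g dκ(z') − ∫Q_s g dκ(z) ≤ a·d(z,z')·√((∫D_s⁺² dκ(z))/s² + 4bL_g²·d(z,z'))` (hypothesis (a) applied to `Q_s g` with
  the local majorants `(sup_{B̄(w,R)} D_s⁺ + R)/s`, `R = 1/(n+1) → 0` by dominated convergence and upper semicontinuity of `D_s⁺`, hypothesis (b) to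
  move the base point);
* ★★ `kuwada_stepB` — TIME step: `∫Q_{s'} g dκ(z') ≤ ∫Q_s g dκ(z') − (s'−s)/(2ss')·∫D_s⁺² dκ(z) + (s'−s)/(2ss')·4bs²L_g²·d(z,z')`;
* ★★★ `kuwada_step` — along points `p, p'` with `d(p,p') ≤ (s'−s)·ρ`, `0 < s₀ ≤ s ≤ s' ≤ 1`:
  `∫Q_{s'} g dκ(p') − ∫Q_s g dκ(p) ≤ (s'−s)·a²ρ²/2 + (s'−s)^{3/2}·K` with `K = 2L_g²/s₀ + 2bL_g²ρ + 2aL_gρ√(bρ)` (Young `aρ√I/s ≤ a²ρ²/2 + I/(2s²)`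
  makes the `I`-terms cancel to order `δ²`).

THEOREMS ONLY, no definition, no sorry.  HONEST FRAMING: abstract metric-measure lemmas; nothing here is specific to Yang–Mills; no crux, rung or
summit statement is proved; the Yang–Mills mass gap is NOT proved.
-/

set_option autoImplicit false

noncomputable section

namespace Summit.QuantumFields.YangMills.Theorems.ColdStartUniversality

open MeasureTheory ProbabilityTheory Filter Topology Set Metric
open scoped BigOperators

variable {X : Type*} [MetricSpace X] [CompactSpace X] [MeasurableSpace X] [BorelSpace X]

/-- `√(u + v) ≤ √u + √v`. [folklore] -/
theorem real_sqrt_add_le' (u v : ℝ) : Real.sqrt (u + v) ≤ Real.sqrt u + Real.sqrt v := by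
  rcases le_or_gt 0 u with hu | hu
  · rcases le_or_gt 0 v with hv | hv
    · rw [Real.sqrt_le_left (by positivity)]
      nlinarith [Real.sq_sqrt hu, Real.sq_sqrt hv, Real.sqrt_nonneg u, Real.sqrt_nonneg v]
    · have : Real.sqrt (u + v) ≤ Real.sqrt u := Real.sqrt_le_sqrt (by linarith)
      linarith [Real.sqrt_nonneg v]
  · have : Real.sqrt (u + v) ≤ Real.sqrt v := Real.sqrt_le_sqrt (by linarith)
    linarith [Real.sqrt_nonneg u]

/-- The square of a nonnegative upper semicontinuous function is upper semicontinuous. [folklore] -/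
theorem upperSemicontinuous_sq_of_nonneg {Y : Type*} [TopologicalSpace Y] {G : Y → ℝ} (hG : UpperSemicontinuous G) (h0 : ∀ w, 0 ≤ G w) :
    UpperSemicontinuous fun w => G w ^ 2 := by
  have hc : Continuous fun u : ℝ => max u 0 ^ 2 := (continuous_id.max continuous_const).pow 2
  have h := hc.comp_upperSemicontinuous hG
    (fun u v huv => by
      show max u 0 ^ 2 ≤ max v 0 ^ 2
      exact pow_le_pow_left₀ (le_max_right _ _) (max_le_max huv le_rfl) 2)
  have heq : (fun w => G w ^ 2) = (fun u : ℝ => max u 0 ^ 2) ∘ G := by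
    funext w; simp [max_eq_left (h0 w)]
  rw [heq]; exact h

/-! ## §1. The space step -/

/-- ★★ **Kuwada's space step.**  Under the gradient hypothesis (a) and the strong Feller hypothesis (b), for `L_g`-Lipschitz continuous `g`, `s > 0`
and all `z, z'`:  `∫Q_s g dκ(z') − ∫Q_s g dκ(z) ≤ a·d(z,z')·√((∫(D_s⁺)² dκ(z))/s² + 4bL_g²·d(z,z'))`.
[cite: BakryGentilLedoux2014, Prop 9.7.1 / Thm 9.7.2] -/
theorem kuwada_stepA (κ : Kernel X X) [IsMarkovKernel κ] {a b : ℝ} (hb : 0 ≤ b)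
    (hSF : ∀ (G : X → ℝ) (M : ℝ), UpperSemicontinuous G → (∀ z, 0 ≤ G z) → (∀ z, G z ≤ M) →
      ∀ x x' : X, |∫ y, G y ∂(κ x') - ∫ y, G y ∂(κ x)| ≤ b * M * dist x x')
    (hG2 : ∀ (F : X → ℝ) (Lf : ℝ), 0 ≤ Lf → (∀ z z' : X, |F z' - F z| ≤ Lf * dist z z') → ∀ (R : ℝ), 0 < R →
      ∀ (G : X → ℝ) (M : ℝ), Measurable G → (∀ w, 0 ≤ G w) → (∀ w, G w ≤ M) →
      (∀ w z' z'' : X, dist w z' ≤ R → dist w z'' ≤ R → |F z'' - F z'| ≤ G w * dist z' z'') →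
      ∀ (x x' : X) (S : ℝ), (∀ z : X, dist x z ≤ dist x x' → ∫ y, G y ^ 2 ∂(κ z) ≤ S) →
        |∫ y, F y ∂(κ x') - ∫ y, F y ∂(κ x)| ≤ a * Real.sqrt S * dist x x')
    {g : X → ℝ} (hg : Continuous g) {Lg : ℝ} (hLg : 0 ≤ Lg) (hlip : ∀ z w, |g z - g w| ≤ Lg * dist z w)
    {s : ℝ} (hs : 0 < s) (z z' : X) :
    ∫ w, (⨅ v, (g v + dist w v ^ 2 / (2 * s))) ∂(κ z') - ∫ w, (⨅ v, (g v + dist w v ^ 2 / (2 * s))) ∂(κ z) ≤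
      a * dist z z' * Real.sqrt ((∫ w, (sSup ((fun v => dist w v) '' {v | ∀ v' : X, g v + dist w v ^ 2 / (2 * s) ≤ g v' + dist w v' ^ 2 / (2 * s)})) ^ 2 ∂(κ z)) / s ^ 2 +
        4 * b * Lg ^ 2 * dist z z') := by
  -- names: `F = Q_s g`, `D = D_s⁺`
  obtain ⟨F, hF⟩ : ∃ F : X → ℝ, F = fun w => ⨅ v, (g v + dist w v ^ 2 / (2 * s)) := ⟨_, rfl⟩
  obtain ⟨D, hD⟩ : ∃ D : X → ℝ, D = fun w => sSup ((fun v => dist w v) '' {v | ∀ v' : X, g v + dist w v ^ 2 / (2 * s) ≤ g v' + dist w v' ^ 2 / (2 * s)}) := ⟨_, rfl⟩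
  have hFw : ∀ w, F w = ⨅ v, (g v + dist w v ^ 2 / (2 * s)) := fun w => by rw [hF]
  have hDw : ∀ w, D w = sSup ((fun v => dist w v) '' {v | ∀ v' : X, g v + dist w v ^ 2 / (2 * s) ≤ g v' + dist w v' ^ 2 / (2 * s)}) := fun w => by rw [hD]
  have hgoal : ∫ w, F w ∂(κ z') - ∫ w, F w ∂(κ z) ≤ a * dist z z' * Real.sqrt ((∫ w, D w ^ 2 ∂(κ z)) / s ^ 2 + 4 * b * Lg ^ 2 * dist z z') := by
    -- basic facts about `F` and `D`
    have hFlip : ∀ u u' : X, |F u' - F u| ≤ 3 * Lg * dist u u' := fun u u' => by rw [hFw, hFw]; exact hopfLax_lipschitz hg hLg hlip hs u u'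
    have hDusc : UpperSemicontinuous D := by rw [hD]; exact hopfLaxFar_upperSemicontinuous hg s
    have hD0 : ∀ w, 0 ≤ D w := fun w => by rw [hDw]; exact hopfLaxFar_nonneg hg s w
    have hDle : ∀ w, D w ≤ 2 * s * Lg := fun w => by rw [hDw]; exact hopfLaxFar_le hg hLg hlip hs w
    have hslope : ∀ u u' : X, F u' - F u ≤ dist u u' * (2 * D u + dist u u') / (2 * s) := fun u u' => by
      rw [hFw, hFw, hDw]; exact hopfLax_slope_le hg hs u u'
    -- the local majorants `G_n(w) = (sup_{B̄(w,R_n)} D + R_n)/s`, `R_n = 1/(n+1)`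
    have hRpos : ∀ n : ℕ, (0 : ℝ) < 1 / ((n : ℝ) + 1) := fun n => by positivity
    have hRle : ∀ n : ℕ, 1 / ((n : ℝ) + 1) ≤ 1 := fun n => by
      rw [div_le_one (by positivity)]; linarith [(Nat.cast_nonneg n : (0 : ℝ) ≤ n)]
    have hsupD0 : ∀ (n : ℕ) (w : X), D w ≤ sSup (D '' closedBall w (1 / ((n : ℝ) + 1))) := fun n w =>
      le_sSup_closedBall hDusc w _ (mem_closedBall_self (hRpos n).le)
    have hsupDle : ∀ (n : ℕ) (w : X), sSup (D '' closedBall w (1 / ((n : ℝ) + 1))) ≤ 2 * s * Lg := fun n w =>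
      csSup_le ⟨D w, ⟨w, mem_closedBall_self (hRpos n).le, rfl⟩⟩ (by rintro _ ⟨v, -, rfl⟩; exact hDle v)
    have hGusc : ∀ n : ℕ, UpperSemicontinuous fun w => (sSup (D '' closedBall w (1 / ((n : ℝ) + 1))) + 1 / ((n : ℝ) + 1)) / s := by
      intro n
      have h1 : UpperSemicontinuous fun w => sSup (D '' closedBall w (1 / ((n : ℝ) + 1))) := upperSemicontinuous_sSup_closedBall hDusc (hRpos n).le
      have h2 : UpperSemicontinuous fun w => sSup (D '' closedBall w (1 / ((n : ℝ) + 1))) + 1 / ((n : ℝ) + 1) := h1.add upperSemicontinuous_const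
      have h3 := (continuous_id.div_const s).comp_upperSemicontinuous h2 (fun u v huv => div_le_div_of_nonneg_right huv hs.le)
      exact h3
    have hG0 : ∀ (n : ℕ) (w : X), 0 ≤ (sSup (D '' closedBall w (1 / ((n : ℝ) + 1))) + 1 / ((n : ℝ) + 1)) / s := fun n w =>
      div_nonneg (by linarith [hD0 w, hsupD0 n w, (hRpos n).le]) hs.le
    have hGM : ∀ (n : ℕ) (w : X), (sSup (D '' closedBall w (1 / ((n : ℝ) + 1))) + 1 / ((n : ℝ) + 1)) / s ≤ (2 * s * Lg + 1 / ((n : ℝ) + 1)) / s :=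
      fun n w => div_le_div_of_nonneg_right (by linarith [hsupDle n w]) hs.le
    -- local Lipschitz data of `F` on balls of radius `R_n`
    have hloc : ∀ (n : ℕ) (w u u' : X), dist w u ≤ 1 / ((n : ℝ) + 1) → dist w u' ≤ 1 / ((n : ℝ) + 1) →
        |F u' - F u| ≤ (sSup (D '' closedBall w (1 / ((n : ℝ) + 1))) + 1 / ((n : ℝ) + 1)) / s * dist u u' := by
      intro n w u u' hu hu'
      have hσu : D u ≤ sSup (D '' closedBall w (1 / ((n : ℝ) + 1))) := le_sSup_closedBall hDusc w _ (by rw [mem_closedBall, dist_comm]; exact hu)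
      have hσu' : D u' ≤ sSup (D '' closedBall w (1 / ((n : ℝ) + 1))) := le_sSup_closedBall hDusc w _ (by rw [mem_closedBall, dist_comm]; exact hu')
      have hdd : dist u u' ≤ 2 * (1 / ((n : ℝ) + 1)) := by
        have := dist_triangle u w u'; rw [dist_comm u w] at this; linarith
      have h1 := hslope u u'
      have h2 := hslope u' u
      rw [dist_comm u' u] at h2
      have hd0 : 0 ≤ dist u u' := dist_nonneg
      have key : ∀ Dv : ℝ, Dv ≤ sSup (D '' closedBall w (1 / ((n : ℝ) + 1))) →
          dist u u' * (2 * Dv + dist u u') / (2 * s) ≤ (sSup (D '' closedBall w (1 / ((n : ℝ) + 1))) + 1 / ((n : ℝ) + 1)) / s * dist u u' := by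
        intro Dv hDv
        have hk : 2 * Dv + dist u u' ≤ 2 * (sSup (D '' closedBall w (1 / ((n : ℝ) + 1))) + 1 / ((n : ℝ) + 1)) := by linarith
        rw [div_mul_eq_mul_div, div_le_div_iff₀ (by linarith) hs]
        calc dist u u' * (2 * Dv + dist u u') * s = (dist u u' * s) * (2 * Dv + dist u u') := by ring
          _ ≤ (dist u u' * s) * (2 * (sSup (D '' closedBall w (1 / ((n : ℝ) + 1))) + 1 / ((n : ℝ) + 1))) :=
              mul_le_mul_of_nonneg_left hk (mul_nonneg hd0 hs.le)
          _ = (sSup (D '' closedBall w (1 / ((n : ℝ) + 1))) + 1 / ((n : ℝ) + 1)) * dist u u' * (2 * s) := by ring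
      rw [abs_le]
      constructor
      · linarith [key (D u') hσu']
      · linarith [key (D u) hσu]
    -- hypothesis (a) at scale `R_n`, with the base point moved by hypothesis (b)
    have hstep : ∀ n : ℕ, |∫ w, F w ∂(κ z') - ∫ w, F w ∂(κ z)| ≤ a * Real.sqrt (∫ w, ((sSup (D '' closedBall w (1 / ((n : ℝ) + 1))) + 1 / ((n : ℝ) + 1)) / s) ^ 2 ∂(κ z) +
        b * ((2 * s * Lg + 1 / ((n : ℝ) + 1)) / s) ^ 2 * dist z z') * dist z z' := by
      intro n
      have hM0 : 0 ≤ (2 * s * Lg + 1 / ((n : ℝ) + 1)) / s := div_nonneg (by positivity) hs.le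
      refine hG2 F (3 * Lg) (by positivity) hFlip (1 / ((n : ℝ) + 1)) (hRpos n) _ ((2 * s * Lg + 1 / ((n : ℝ) + 1)) / s) (hGusc n).measurable
        (hG0 n) (hGM n) (hloc n) z z' _ fun u hu => ?_
      -- `∫ G_n² dκ(u) ≤ ∫ G_n² dκ(z) + b·M_n²·d(z,z')` by (b) for the u.s.c. function `G_n²`
      have husc2 : UpperSemicontinuous fun w => ((sSup (D '' closedBall w (1 / ((n : ℝ) + 1))) + 1 / ((n : ℝ) + 1)) / s) ^ 2 :=
        upperSemicontinuous_sq_of_nonneg (hGusc n) (hG0 n)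
      have h2 := hSF _ (((2 * s * Lg + 1 / ((n : ℝ) + 1)) / s) ^ 2) husc2 (fun w => sq_nonneg _)
        (fun w => pow_le_pow_left₀ (hG0 n w) (hGM n w) 2) z u
      have h3 : b * ((2 * s * Lg + 1 / ((n : ℝ) + 1)) / s) ^ 2 * dist z u ≤ b * ((2 * s * Lg + 1 / ((n : ℝ) + 1)) / s) ^ 2 * dist z z' :=
        mul_le_mul_of_nonneg_left hu (by positivity)
      linarith [(abs_le.1 h2).2]
    -- the limit `n → ∞`: dominated convergence
    have hlimG : ∀ w, Tendsto (fun n : ℕ => ((sSup (D '' closedBall w (1 / ((n : ℝ) + 1))) + 1 / ((n : ℝ) + 1)) / s) ^ 2) atTop (𝓝 ((D w / s) ^ 2)) := by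
      intro w
      have h1 : Tendsto (fun n : ℕ => sSup (D '' closedBall w (1 / ((n : ℝ) + 1)))) atTop (𝓝 (D w)) := tendsto_sSup_closedBall hDusc w
      have h2 : Tendsto (fun n : ℕ => 1 / ((n : ℝ) + 1)) atTop (𝓝 0) := tendsto_one_div_add_atTop_nhds_zero_nat
      have h3 := ((h1.add h2).div_const s).pow 2
      rw [add_zero] at h3
      exact h3
    have hlimI : Tendsto (fun n : ℕ => ∫ w, ((sSup (D '' closedBall w (1 / ((n : ℝ) + 1))) + 1 / ((n : ℝ) + 1)) / s) ^ 2 ∂(κ z)) atTop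
        (𝓝 (∫ w, (D w / s) ^ 2 ∂(κ z))) := by
      refine tendsto_integral_of_dominated_convergence (fun _ => ((2 * s * Lg + 1) / s) ^ 2) (fun n => (hGusc n).measurable.pow_const 2 |>.aestronglyMeasurable)
        (integrable_const _) (fun n => ae_of_all _ fun w => ?_) (ae_of_all _ hlimG)
      rw [Real.norm_eq_abs, abs_of_nonneg (sq_nonneg _)]
      exact pow_le_pow_left₀ (hG0 n w) ((hGM n w).trans (div_le_div_of_nonneg_right (by linarith [hRle n]) hs.le)) 2
    have hlimM : Tendsto (fun n : ℕ => b * ((2 * s * Lg + 1 / ((n : ℝ) + 1)) / s) ^ 2 * dist z z') atTop (𝓝 (b * ((2 * s * Lg + 0) / s) ^ 2 * dist z z')) :=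
      ((((tendsto_const_nhds.add tendsto_one_div_add_atTop_nhds_zero_nat).div_const s).pow 2).const_mul b).mul_const _
    have hlim : Tendsto (fun n : ℕ => a * Real.sqrt (∫ w, ((sSup (D '' closedBall w (1 / ((n : ℝ) + 1))) + 1 / ((n : ℝ) + 1)) / s) ^ 2 ∂(κ z) +
        b * ((2 * s * Lg + 1 / ((n : ℝ) + 1)) / s) ^ 2 * dist z z') * dist z z') atTop
        (𝓝 (a * Real.sqrt (∫ w, (D w / s) ^ 2 ∂(κ z) + b * ((2 * s * Lg + 0) / s) ^ 2 * dist z z') * dist z z')) :=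
      (((hlimI.add hlimM).sqrt).const_mul a).mul_const _
    have hle := ge_of_tendsto' hlim hstep
    have hI : ∫ w, (D w / s) ^ 2 ∂(κ z) = (∫ w, D w ^ 2 ∂(κ z)) / s ^ 2 := by
      rw [eq_div_iff (by positivity), ← integral_mul_const]
      refine integral_congr_ae (ae_of_all _ fun w => ?_)
      show (D w / s) ^ 2 * s ^ 2 = D w ^ 2
      field_simp
    have hM : b * ((2 * s * Lg + 0) / s) ^ 2 * dist z z' = 4 * b * Lg ^ 2 * dist z z' := by
      field_simp; ring
    rw [hI, hM] at hle
    calc ∫ w, F w ∂(κ z') - ∫ w, F w ∂(κ z) ≤ |∫ w, F w ∂(κ z') - ∫ w, F w ∂(κ z)| := le_abs_self _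
      _ ≤ a * Real.sqrt ((∫ w, D w ^ 2 ∂(κ z)) / s ^ 2 + 4 * b * Lg ^ 2 * dist z z') * dist z z' := hle
      _ = a * dist z z' * Real.sqrt ((∫ w, D w ^ 2 ∂(κ z)) / s ^ 2 + 4 * b * Lg ^ 2 * dist z z') := by ring
  rw [hF, hD] at hgoal
  exact hgoal

/-! ## §2. The time step -/

/-- ★★ **Kuwada's time step.**  For `0 < s ≤ s'` and all `z, z'`:
`∫Q_{s'} g dκ(z') ≤ ∫Q_s g dκ(z') − (s'−s)/(2ss')·∫(D_s⁺)² dκ(z) + (s'−s)/(2ss')·(b·(2sL_g)²·d(z,z'))` (G62's `hopfLax_time_le` integrated, base point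
moved by the strong Feller hypothesis (b)). [cite: BakryGentilLedoux2014, Prop 9.7.1 / Thm 9.7.2] -/
theorem kuwada_stepB (κ : Kernel X X) [IsMarkovKernel κ] {b : ℝ}
    (hSF : ∀ (G : X → ℝ) (M : ℝ), UpperSemicontinuous G → (∀ z, 0 ≤ G z) → (∀ z, G z ≤ M) →
      ∀ x x' : X, |∫ y, G y ∂(κ x') - ∫ y, G y ∂(κ x)| ≤ b * M * dist x x')
    {g : X → ℝ} (hg : Continuous g) {Lg : ℝ} (hLg : 0 ≤ Lg) (hlip : ∀ z w, |g z - g w| ≤ Lg * dist z w)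
    {s s' : ℝ} (hs : 0 < s) (hss' : s ≤ s') (z z' : X) :
    ∫ w, (⨅ v, (g v + dist w v ^ 2 / (2 * s'))) ∂(κ z') ≤ ∫ w, (⨅ v, (g v + dist w v ^ 2 / (2 * s))) ∂(κ z') -
      (s' - s) / (2 * s * s') * ∫ w, (sSup ((fun v => dist w v) '' {v | ∀ v' : X, g v + dist w v ^ 2 / (2 * s) ≤ g v' + dist w v' ^ 2 / (2 * s)})) ^ 2 ∂(κ z) +
      (s' - s) / (2 * s * s') * (b * (2 * s * Lg) ^ 2 * dist z z') := by
  obtain ⟨D, hD⟩ : ∃ D : X → ℝ, D = fun w => sSup ((fun v => dist w v) '' {v | ∀ v' : X, g v + dist w v ^ 2 / (2 * s) ≤ g v' + dist w v' ^ 2 / (2 * s)}) := ⟨_, rfl⟩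
  have hDw : ∀ w, D w = sSup ((fun v => dist w v) '' {v | ∀ v' : X, g v + dist w v ^ 2 / (2 * s) ≤ g v' + dist w v' ^ 2 / (2 * s)}) := fun w => by rw [hD]
  have hs' : 0 < s' := lt_of_lt_of_le hs hss'
  have hDusc : UpperSemicontinuous D := by rw [hD]; exact hopfLaxFar_upperSemicontinuous hg s
  have hD0 : ∀ w, 0 ≤ D w := fun w => by rw [hDw]; exact hopfLaxFar_nonneg hg s w
  have hDle : ∀ w, D w ≤ 2 * s * Lg := fun w => by rw [hDw]; exact hopfLaxFar_le hg hLg hlip hs w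
  have hc0 : 0 ≤ (s' - s) / (2 * s * s') := div_nonneg (by linarith) (by positivity)
  -- pointwise time inequality
  have hpt : ∀ w, (⨅ v, (g v + dist w v ^ 2 / (2 * s'))) ≤ (⨅ v, (g v + dist w v ^ 2 / (2 * s))) - (s' - s) / (2 * s * s') * D w ^ 2 := fun w => by
    rw [hDw]; exact hopfLax_time_le hg hs hss' w
  -- integrability
  have hQc : Continuous fun w => ⨅ v, (g v + dist w v ^ 2 / (2 * s)) := hopfLax_continuous hg hLg hlip hs
  have hQc' : Continuous fun w => ⨅ v, (g v + dist w v ^ 2 / (2 * s')) := hopfLax_continuous hg hLg hlip hs'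
  have hQi : ∀ u : X, Integrable (fun w => ⨅ v, (g v + dist w v ^ 2 / (2 * s))) (κ u) := fun u =>
    hQc.integrable_of_hasCompactSupport (HasCompactSupport.of_compactSpace _)
  have hQi' : ∀ u : X, Integrable (fun w => ⨅ v, (g v + dist w v ^ 2 / (2 * s'))) (κ u) := fun u =>
    hQc'.integrable_of_hasCompactSupport (HasCompactSupport.of_compactSpace _)
  have hD2i : ∀ u : X, Integrable (fun w => D w ^ 2) (κ u) := fun u =>
    (memLp_of_bounded (a := 0) (b := (2 * s * Lg) ^ 2) (ae_of_all _ fun w => ⟨sq_nonneg _, pow_le_pow_left₀ (hD0 w) (hDle w) 2⟩)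
      (hDusc.measurable.pow_const 2).aestronglyMeasurable 1).integrable le_rfl
  have h1 : ∫ w, (⨅ v, (g v + dist w v ^ 2 / (2 * s'))) ∂(κ z') ≤ ∫ w, ((⨅ v, (g v + dist w v ^ 2 / (2 * s))) - (s' - s) / (2 * s * s') * D w ^ 2) ∂(κ z') :=
    integral_mono (hQi' z') ((hQi z').sub ((hD2i z').const_mul _)) hpt
  rw [integral_sub (hQi z') ((hD2i z').const_mul _), integral_const_mul] at h1
  -- move the base point of `∫D² dκ` from `z'` to `z`
  have husc2 : UpperSemicontinuous fun w => D w ^ 2 := upperSemicontinuous_sq_of_nonneg hDusc hD0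
  have h2 := hSF _ ((2 * s * Lg) ^ 2) husc2 (fun w => sq_nonneg _) (fun w => pow_le_pow_left₀ (hD0 w) (hDle w) 2) z z'
  have h3 : ∫ w, D w ^ 2 ∂(κ z) - b * (2 * s * Lg) ^ 2 * dist z z' ≤ ∫ w, D w ^ 2 ∂(κ z') := by linarith [(abs_le.1 h2).1]
  have h4 := mul_le_mul_of_nonneg_left h3 hc0
  simp only [hD] at h1 h4
  linarith

/-! ## §3. One step along the geodesic -/

/-- ★★★ **Kuwada's step estimate.**  Under (a), (b): for `L_g`-Lipschitz continuous `g`, `0 < s₀ ≤ s ≤ s' ≤ 1`, `ρ ≥ 0` and points `p, p'` with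
`d(p,p') ≤ (s'−s)·ρ`:  `∫Q_{s'} g dκ(p') − ∫Q_s g dκ(p) ≤ (s'−s)·a²ρ²/2 + (s'−s)·√(s'−s)·K`, `K = 2L_g²/s₀ + 2bL_g²ρ + 2aL_gρ√(bρ)`.
[cite: BakryGentilLedoux2014, Prop 9.7.1 / Thm 9.7.2] -/
theorem kuwada_step (κ : Kernel X X) [IsMarkovKernel κ] {a b : ℝ} (ha : 0 ≤ a) (hb : 0 ≤ b)
    (hSF : ∀ (G : X → ℝ) (M : ℝ), UpperSemicontinuous G → (∀ z, 0 ≤ G z) → (∀ z, G z ≤ M) →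
      ∀ x x' : X, |∫ y, G y ∂(κ x') - ∫ y, G y ∂(κ x)| ≤ b * M * dist x x')
    (hG2 : ∀ (F : X → ℝ) (Lf : ℝ), 0 ≤ Lf → (∀ z z' : X, |F z' - F z| ≤ Lf * dist z z') → ∀ (R : ℝ), 0 < R →
      ∀ (G : X → ℝ) (M : ℝ), Measurable G → (∀ w, 0 ≤ G w) → (∀ w, G w ≤ M) →
      (∀ w z' z'' : X, dist w z' ≤ R → dist w z'' ≤ R → |F z'' - F z'| ≤ G w * dist z' z'') →
      ∀ (x x' : X) (S : ℝ), (∀ z : X, dist x z ≤ dist x x' → ∫ y, G y ^ 2 ∂(κ z) ≤ S) →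
        |∫ y, F y ∂(κ x') - ∫ y, F y ∂(κ x)| ≤ a * Real.sqrt S * dist x x')
    {g : X → ℝ} (hg : Continuous g) {Lg : ℝ} (hLg : 0 ≤ Lg) (hlip : ∀ z w, |g z - g w| ≤ Lg * dist z w)
    {s₀ s s' ρ : ℝ} (hs₀ : 0 < s₀) (hs₀s : s₀ ≤ s) (hss' : s ≤ s') (hs'1 : s' ≤ 1) (hρ : 0 ≤ ρ)
    (p p' : X) (hpp' : dist p p' ≤ (s' - s) * ρ) :
    ∫ w, (⨅ v, (g v + dist w v ^ 2 / (2 * s'))) ∂(κ p') - ∫ w, (⨅ v, (g v + dist w v ^ 2 / (2 * s))) ∂(κ p) ≤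
      (s' - s) * (a ^ 2 * ρ ^ 2 / 2) + (s' - s) * Real.sqrt (s' - s) * (2 * Lg ^ 2 / s₀ + 2 * b * Lg ^ 2 * ρ + 2 * a * Lg * ρ * Real.sqrt (b * ρ)) := by
  have hs : 0 < s := lt_of_lt_of_le hs₀ hs₀s
  have hs' : 0 < s' := lt_of_lt_of_le hs hss'
  obtain ⟨δ, hδ⟩ : ∃ δ : ℝ, δ = s' - s := ⟨_, rfl⟩
  have hδ0 : 0 ≤ δ := by rw [hδ]; linarith
  have hδ1 : δ ≤ 1 := by rw [hδ]; linarith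
  obtain ⟨I, hI⟩ : ∃ I : ℝ, I = ∫ w, (sSup ((fun v => dist w v) '' {v | ∀ v' : X, g v + dist w v ^ 2 / (2 * s) ≤ g v' + dist w v' ^ 2 / (2 * s)})) ^ 2 ∂(κ p) := ⟨_, rfl⟩
  have hA := kuwada_stepA κ hb hSF hG2 hg hLg hlip hs p p'
  have hB := kuwada_stepB κ hSF hg hLg hlip hs hss' p p'
  rw [← hI] at hA hB
  rw [← hδ] at hB hpp' ⊢
  -- bounds on `I`
  have hI0 : 0 ≤ I := by rw [hI]; exact integral_nonneg fun w => sq_nonneg _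
  have hIle : I ≤ (2 * s * Lg) ^ 2 := by
    rw [hI]
    haveI : IsProbabilityMeasure (κ p) := IsMarkovKernel.isProbabilityMeasure p
    have h0 : ∀ w, 0 ≤ sSup ((fun v => dist w v) '' {v | ∀ v' : X, g v + dist w v ^ 2 / (2 * s) ≤ g v' + dist w v' ^ 2 / (2 * s)}) :=
      fun w => hopfLaxFar_nonneg hg s w
    have hle : ∀ w, sSup ((fun v => dist w v) '' {v | ∀ v' : X, g v + dist w v ^ 2 / (2 * s) ≤ g v' + dist w v' ^ 2 / (2 * s)}) ≤ 2 * s * Lg :=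
      fun w => hopfLaxFar_le hg hLg hlip hs w
    calc _ ≤ ∫ _w, (2 * s * Lg) ^ 2 ∂(κ p) := integral_mono_of_nonneg (ae_of_all _ fun w => sq_nonneg _) (integrable_const _)
          (ae_of_all _ fun w => pow_le_pow_left₀ (h0 w) (hle w) 2)
      _ = (2 * s * Lg) ^ 2 := by simp
  -- monotonicity in the distance: replace `d(p,p')` by `δρ`
  have hd0 : 0 ≤ dist p p' := dist_nonneg
  have hδρ : 0 ≤ δ * ρ := mul_nonneg hδ0 hρ
  have hA' : ∫ w, (⨅ v, (g v + dist w v ^ 2 / (2 * s))) ∂(κ p') - ∫ w, (⨅ v, (g v + dist w v ^ 2 / (2 * s))) ∂(κ p) ≤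
      a * (δ * ρ) * Real.sqrt (I / s ^ 2 + 4 * b * Lg ^ 2 * (δ * ρ)) := by
    refine hA.trans ?_
    have h0 : 4 * b * Lg ^ 2 * dist p p' ≤ 4 * b * Lg ^ 2 * (δ * ρ) := mul_le_mul_of_nonneg_left hpp' (by positivity)
    have h1 : Real.sqrt (I / s ^ 2 + 4 * b * Lg ^ 2 * dist p p') ≤ Real.sqrt (I / s ^ 2 + 4 * b * Lg ^ 2 * (δ * ρ)) :=
      Real.sqrt_le_sqrt (by linarith)
    calc a * dist p p' * Real.sqrt (I / s ^ 2 + 4 * b * Lg ^ 2 * dist p p') ≤ a * dist p p' * Real.sqrt (I / s ^ 2 + 4 * b * Lg ^ 2 * (δ * ρ)) :=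
          mul_le_mul_of_nonneg_left h1 (by positivity)
      _ ≤ a * (δ * ρ) * Real.sqrt (I / s ^ 2 + 4 * b * Lg ^ 2 * (δ * ρ)) := by
          exact mul_le_mul_of_nonneg_right (mul_le_mul_of_nonneg_left hpp' ha) (Real.sqrt_nonneg _)
  have hB' : ∫ w, (⨅ v, (g v + dist w v ^ 2 / (2 * s'))) ∂(κ p') ≤ ∫ w, (⨅ v, (g v + dist w v ^ 2 / (2 * s))) ∂(κ p') -
      δ / (2 * s * s') * I + δ / (2 * s * s') * (b * (2 * s * Lg) ^ 2 * (δ * ρ)) := by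
    refine hB.trans ?_
    have hc0 : 0 ≤ δ / (2 * s * s') := div_nonneg hδ0 (by positivity)
    have h1 : b * (2 * s * Lg) ^ 2 * dist p p' ≤ b * (2 * s * Lg) ^ 2 * (δ * ρ) := mul_le_mul_of_nonneg_left hpp' (by positivity)
    have h2 := mul_le_mul_of_nonneg_left h1 hc0
    linarith
  -- the variable `y = √I/s ∈ [0, 2L_g]`, `I = (s y)²`
  obtain ⟨y, hy⟩ : ∃ y : ℝ, y = Real.sqrt I / s := ⟨_, rfl⟩
  have hy0 : 0 ≤ y := by rw [hy]; positivity
  have hsy : s * y = Real.sqrt I := by rw [hy]; field_simp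
  have hIy : I = (s * y) ^ 2 := by rw [hsy, Real.sq_sqrt hI0]
  have hyle : y ≤ 2 * Lg := by
    have h1 : Real.sqrt I ≤ 2 * s * Lg := by
      rw [← Real.sqrt_sq (by positivity : (0 : ℝ) ≤ 2 * s * Lg)]; exact Real.sqrt_le_sqrt hIle
    have h2 : s * y ≤ s * (2 * Lg) := by rw [hsy]; linarith
    exact le_of_mul_le_mul_left h2 hs
  -- `√(u+v) ≤ √u + √v`, `√(I/s²) = y`, `√(4bL²δρ) = 2L√(bδρ)`
  have hsq1 : Real.sqrt (I / s ^ 2 + 4 * b * Lg ^ 2 * (δ * ρ)) ≤ y + 2 * Lg * Real.sqrt (b * (δ * ρ)) := by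
    refine (real_sqrt_add_le' _ _).trans (le_of_eq ?_)
    rw [Real.sqrt_div' _ (sq_nonneg s), Real.sqrt_sq hs.le, ← hy,
      show 4 * b * Lg ^ 2 * (δ * ρ) = (2 * Lg) ^ 2 * (b * (δ * ρ)) by ring, Real.sqrt_mul' _ (by positivity), Real.sqrt_sq (by positivity)]
  have hsqδ : Real.sqrt (b * (δ * ρ)) = Real.sqrt δ * Real.sqrt (b * ρ) := by
    rw [show b * (δ * ρ) = δ * (b * ρ) by ring, Real.sqrt_mul hδ0]
  have hδsq : δ ≤ Real.sqrt δ := by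
    have h := Real.sqrt_le_sqrt hδ1
    rw [Real.sqrt_one] at h
    calc δ = Real.sqrt δ * Real.sqrt δ := (Real.mul_self_sqrt hδ0).symm
      _ ≤ Real.sqrt δ * 1 := mul_le_mul_of_nonneg_left h (Real.sqrt_nonneg _)
      _ = Real.sqrt δ := mul_one _
  -- combine the two steps
  have hmain : ∫ w, (⨅ v, (g v + dist w v ^ 2 / (2 * s'))) ∂(κ p') - ∫ w, (⨅ v, (g v + dist w v ^ 2 / (2 * s))) ∂(κ p) ≤
      -(δ / (2 * s * s')) * I + δ / (2 * s * s') * (b * (2 * s * Lg) ^ 2 * (δ * ρ)) + a * (δ * ρ) * (y + 2 * Lg * Real.sqrt (b * (δ * ρ))) := by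
    have h1 : a * (δ * ρ) * Real.sqrt (I / s ^ 2 + 4 * b * Lg ^ 2 * (δ * ρ)) ≤ a * (δ * ρ) * (y + 2 * Lg * Real.sqrt (b * (δ * ρ))) :=
      mul_le_mul_of_nonneg_left hsq1 (by positivity)
    linarith
  -- (T1) `−δ/(2ss')·I + aδρ·y ≤ δ·a²ρ²/2 + δ²·(2L²/s₀)`
  have hT1 : -(δ / (2 * s * s')) * I + a * (δ * ρ) * y ≤ δ * (a ^ 2 * ρ ^ 2 / 2) + δ * δ * (2 * Lg ^ 2 / s₀) := by
    have hyoung : a * ρ * y ≤ a ^ 2 * ρ ^ 2 / 2 + y ^ 2 / 2 := by nlinarith [sq_nonneg (a * ρ - y)]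
    have h1 : a * (δ * ρ) * y ≤ δ * (a ^ 2 * ρ ^ 2 / 2) + δ * (y ^ 2 / 2) := by
      have := mul_le_mul_of_nonneg_left hyoung hδ0
      have e : a * (δ * ρ) * y = δ * (a * ρ * y) := by ring
      rw [e]; linarith
    -- `−δ/(2ss')·(sy)² + δy²/2 = δ²y²/(2s')`
    have h2 : -(δ / (2 * s * s')) * I + δ * (y ^ 2 / 2) = δ * δ * y ^ 2 / (2 * s') := by
      rw [hIy, hδ]; field_simp; ring
    -- `δ²y²/(2s') ≤ δ²·2L²/s₀`
    have h3 : δ * δ * y ^ 2 / (2 * s') ≤ δ * δ * (2 * Lg ^ 2 / s₀) := by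
      have hy2 : y ^ 2 ≤ (2 * Lg) ^ 2 := pow_le_pow_left₀ hy0 hyle 2
      have hδδ0 : 0 ≤ δ * δ := mul_nonneg hδ0 hδ0
      calc δ * δ * y ^ 2 / (2 * s') ≤ δ * δ * (2 * Lg) ^ 2 / (2 * s') := by
            exact div_le_div_of_nonneg_right (mul_le_mul_of_nonneg_left hy2 hδδ0) (by positivity)
        _ ≤ δ * δ * (2 * Lg) ^ 2 / (2 * s₀) :=
            div_le_div_of_nonneg_left (by positivity) (by positivity) (by linarith)
        _ = δ * δ * (2 * Lg ^ 2 / s₀) := by field_simp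
    linarith
  -- (T2) `δ/(2ss')·(b(2sL)²δρ) ≤ δ²·2bL²ρ`
  have hT2 : δ / (2 * s * s') * (b * (2 * s * Lg) ^ 2 * (δ * ρ)) ≤ δ * δ * (2 * b * Lg ^ 2 * ρ) := by
    rw [div_mul_eq_mul_div, div_le_iff₀ (by positivity)]
    have hK : 0 ≤ 4 * b * s * Lg ^ 2 * δ * δ * ρ := by positivity
    calc δ * (b * (2 * s * Lg) ^ 2 * (δ * ρ)) = (4 * b * s * Lg ^ 2 * δ * δ * ρ) * s := by ring
      _ ≤ (4 * b * s * Lg ^ 2 * δ * δ * ρ) * s' := mul_le_mul_of_nonneg_left hss' hK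
      _ = δ * δ * (2 * b * Lg ^ 2 * ρ) * (2 * s * s') := by ring
  -- (T3) `aδρ·2L√(bδρ) = δ√δ·2aLρ√(bρ)`
  have hT3 : a * (δ * ρ) * (2 * Lg * Real.sqrt (b * (δ * ρ))) = δ * Real.sqrt δ * (2 * a * Lg * ρ * Real.sqrt (b * ρ)) := by
    rw [hsqδ]; ring
  -- `δ² ≤ δ√δ`
  have hδδ : δ * δ ≤ δ * Real.sqrt δ := mul_le_mul_of_nonneg_left hδsq hδ0
  have hK1 : δ * δ * (2 * Lg ^ 2 / s₀) ≤ δ * Real.sqrt δ * (2 * Lg ^ 2 / s₀) := mul_le_mul_of_nonneg_right hδδ (by positivity)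
  have hK2 : δ * δ * (2 * b * Lg ^ 2 * ρ) ≤ δ * Real.sqrt δ * (2 * b * Lg ^ 2 * ρ) := mul_le_mul_of_nonneg_right hδδ (by positivity)
  have hsplit : a * (δ * ρ) * (y + 2 * Lg * Real.sqrt (b * (δ * ρ))) = a * (δ * ρ) * y + a * (δ * ρ) * (2 * Lg * Real.sqrt (b * (δ * ρ))) := by ring
  have hfinal : -(δ / (2 * s * s')) * I + δ / (2 * s * s') * (b * (2 * s * Lg) ^ 2 * (δ * ρ)) + a * (δ * ρ) * (y + 2 * Lg * Real.sqrt (b * (δ * ρ))) ≤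
      δ * (a ^ 2 * ρ ^ 2 / 2) + δ * Real.sqrt δ * (2 * Lg ^ 2 / s₀ + 2 * b * Lg ^ 2 * ρ + 2 * a * Lg * ρ * Real.sqrt (b * ρ)) := by
    rw [hsplit, hT3]
    have e : δ * Real.sqrt δ * (2 * Lg ^ 2 / s₀ + 2 * b * Lg ^ 2 * ρ + 2 * a * Lg * ρ * Real.sqrt (b * ρ)) =
        δ * Real.sqrt δ * (2 * Lg ^ 2 / s₀) + δ * Real.sqrt δ * (2 * b * Lg ^ 2 * ρ) + δ * Real.sqrt δ * (2 * a * Lg * ρ * Real.sqrt (b * ρ)) := by ring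
    rw [e]
    linarith
  exact hmain.trans hfinal

end Summit.QuantumFields.YangMills.Theorems.ColdStartUniversality

end
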